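import Summits.CriticalPhenomena.PercolationContinuityZ3.Theorems.PercNearOneGluingNoHeavyQuantTreeBuiltRows
import HarnessLib

/-!
# QUANT lane R8: the tree row NEEDS NO DEC — `Quant.FarTreeRow` follows from the DEPTH-0 single-gate closure of the
# layer-free TWO-LAYER-BOUND family (`LawDec.TLB`, its gate-stable form `LawDec.STLB`, the node `LawDec.TLBGateConvClosed`,
# and the kernel reduction `farTreeRow_of_tlbGateConvClosed`)

builds on p205010 (kernel theorem, internal audit signed; external expert review pending)

Statement + support file (`--supports stmt-CriticalPhenomena-4575`), QUANT lane LEAD seat prim-quant-lead (gen 37), rung R8 of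
`run/shared/lean/prim/quant/LADDER.md`; lead finding V358 (lane `README.md`), lane INBOX 2026-08-24 (lead g37 seating line).
Two `Prop` definitions with parameters, one `@[conjecture]`, theorems with standard axioms, no sorries.

THE OBSERVATION.  Every law-level route of record to the tree row (`SDECConvClosed ⟹ TreeBuiltDEC ⟹ TreeBuiltFAR ⟹ FarTreeRow`,
census-2 g53 / lead g20; `SingleGateConvClosed`, lead g28; its normal form `SGCGiantStep`, typer g33; `AD3ConvClosedTB`, typer g32)
carries the DECOMPOSITION property DEC(j′) of `…QuantLawDEC` through the structural induction `LawDec.TreeBuilt`, and reads the row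
off DEC at a dominant layer (`tail_ge_of_decAt`).  But the row is read off a much smaller part of DEC: the TWO-LAYER BOUNDS.  For a law
`ν` on `{0..M}`, a target `τ` and a rate `u`, let

  `TLB u τ M ν`  :=  for every integer `d` with `2d < τ`:  `u · ν{h ≤ d} ≤ ν{h ≤ M : τ − d ≤ h}`.

This is the family of ALL two-layer bounds "`y·ν{≤ i′} ≤ (1−y)·ν{> j}` for `i′ ≤ j`, `i′ + j < τ`" (`u = y/(1−y)`; for each `d = i′`
the binding layer is the largest `j < τ − d`), i.e. census-2 g63's depth-0 family (NP-STEP-G63 §4 (A)); every DEC law satisfies it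
(`deepLows_le_giants`: atoms `t ≤ d` are compatible with no mid `≤ j` when `d + j < τ`, so they ride giants only, at rate `u`); it is
LAYER-FREE; and it is Hall's condition for the flat transport "ship `u ×` every atom `t < τ/2` into atoms `t′ ≥ τ − t`" — `u` times
the lower half of `ν`, reflected about `τ/2`, fits under the upper tail.  At `d = j` with `2j < τ` it IS the far-relay row
(`treeBuiltFAR_of_treeBuilt_stlb` below).  `TLB` is not closed under gating alone (the phantom zero `1 − q` costs `u′(1−q)` at first
order: `μ = {1: 0.4739…, 2: 0.0728…, 6: 0.4533…}`, `q = 0.984…`, floor at the TLB threshold — lead g37 explore/c_check.py), so, exactly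
as SDEC was to DEC, the induction carries the GATE-STABLE form

  `STLB x M μ`  :=  for every gate `0 < q ≤ 1`:  `TLB (qx/(1−qx)) (q·mean μ) M (gate μ q)`,

which is closed under `TreeBuilt.nil`, `.relay` (`x ≤ 1`), `.gate` (gates compose) and `.mono` (smaller rate) for free, and under
`TreeBuilt.conv` as soon as the SINGLE-GATE DEPTH-0 STATEMENT holds:

* **`LawDec.TLBGateConvClosed`** (`@[conjecture]`, "D0-SGC", the binder of `LawDec.SingleGateConvClosed` with DEC replaced by TLB on
  both sides): `0 < y < 1`, `0 < q ≤ 1`, probability laws `μ₁`, `μ₂` on `{0..M₁}`, `{0..M₂}` with `y·Mᵢ ≤ q·Tᵢ` and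
  `TLB (y/(1−y)) (q·Tᵢ) Mᵢ (gate μᵢ q)`  ⟹  `TLB (y/(1−y)) (q·(T₁+T₂)) (M₁+M₂) (gate (lconv M₁ M₂ μ₁ μ₂) q)`.
* **`LawDec.treeBuilt_stlb`**: under `TLBGateConvClosed` every tree-built law is STLB at its floor (census-2 g53's induction
  `treeBuilt_sdec` with STLB in place of SDEC).
* **`LawDec.treeBuiltFAR_of_tlbGateConvClosed : TLBGateConvClosed → TreeBuiltFAR`** and
  **`Quant.farTreeRow_of_tlbGateConvClosed : TLBGateConvClosed → FarTreeRow`** — the tree row with NO decomposition property, no flows at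
  varying rates, no cells, no AP/NP dichotomy.

EVIDENCE for `TLBGateConvClosed` (exact unless said): census-2 g63 NP-STEP-G63 §4 (A) (product two-layer bounds from factor two-layer
bounds + top-affordability ONLY: 43 902 `(j, i′)` tests / 0 failures incl. 651 pairs with a non-DEC factor, `M ≤ 9`); lead g37: exact
alternating-LP adversary (maximise one product bound over the two factor polytopes {mass, mean, TLB rows} by alternating exact simplex
from random vertices): 299 instances `M ≤ 7`, `q ∈ {1, .99, .95, .9, .75, .5, k/20}`, `y` on a `1/20` grid incl. `y = q` — worst
violation EXACTLY `0` (equality: E-tight blobs); structured random pairs `M ≤ 14`: 4 469 / 0; the family `TLB` itself on 800 random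
weighted trees (`n ≤ 16`, direct DP): 0 failures; kit j211243 / j211244 / j211245 (float alternating adversary with exact re-check,
`M ≤ 12` / `M ≤ 20` / mean equality dropped) — item stmt-CriticalPhenomena-4575 evidence.  HONEST STATUS: `TLBGateConvClosed`,
`TreeBuiltFAR`, `FarTreeRow` are OPEN; the reductions are kernel; nothing here is a published result; the RATE class log\* and the honest
sentence of `run/shared/lean/prim/quant/README.md` are unchanged.

[this work]; two-layer bounds as necessary conditions of DEC: prim-quant-arm-2 g33/g34 (`deepLows_le_giants`, `gateConv_tail_ge_dominant`
= the `i′ = j` case of the node), census-2 g63 NP-STEP-G63 §4; the structural induction: prim-quant-census-2 g53 (`treeBuilt_sdec`);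
`TreeBuiltFAR ⟹ FarTreeRow`: lead g20 / typer g22 (this lane).  The gluing rows served [cite: KozmaNitzan2024, Conjecture 3 (p. 15)];
product measure [cite: Grimmett1999, §1.3 p. 10].
-/

noncomputable section

namespace Summit.CriticalPhenomena.PercolationContinuityZ3.Theorems

namespace Quant

open Finset

namespace LawDec

/-! ### The two-layer-bound family and its gate-stable form -/

/-- **THE TWO-LAYER-BOUND FAMILY `TLB u τ M ν`** (layer-free): for every integer `d` with `2d < τ`,
`u · Σ_{h ≤ d} ν h ≤ Σ_{h ≤ M, τ − d ≤ h} ν h` — all the two-layer bounds "`y·ν{≤ i′} ≤ (1−y)·ν{> j}`, `i′ ≤ j`, `i′ + j < τ`"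
(`u = y/(1−y)`) at once; Hall's condition for shipping `u ×` every atom below `τ/2` into the atoms `≥ τ −` itself. [this work] -/
def TLB (u τ : ℝ) (M : ℕ) (ν : ℕ → ℝ) : Prop :=
  ∀ d : ℕ, 2 * (d : ℝ) < τ →
    u * ∑ h ∈ Finset.range (d + 1), ν h ≤ ∑ h ∈ Finset.range (M + 1), (if τ - d ≤ (h : ℝ) then ν h else 0)

/-- **GATE-STABLE TWO-LAYER BOUNDS `STLB x M μ`** (the TLB analogue of `LawDec.SDEC`): for every gate `0 < q ≤ 1`, the gated law
`gate μ q` satisfies `TLB` at rate `qx/(1 − qx)` (floor `qx`) and target `q · mean μ`. [this work] -/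
def STLB (x : ℝ) (M : ℕ) (μ : ℕ → ℝ) : Prop :=
  ∀ q : ℝ, 0 < q → q ≤ 1 →
    TLB (q * x / (1 - q * x)) (q * ∑ h ∈ Finset.range (M + 1), (h : ℝ) * μ h) M (gate μ q)

/-! ### The node: depth-0 single-gate convolution closure -/

/-- **CONJECTURE (D0-SGC, THE DEPTH-0 SINGLE-GATE CLOSURE; lead g37, V358).**  In the binder of `LawDec.SingleGateConvClosed` with the
decomposition property replaced by the two-layer-bound family on both sides: for a floor `0 < y < 1`, one gate `0 < q ≤ 1`, probability
laws `μ₁` on `{0..M₁}`, `μ₂` on `{0..M₂}` whose gated versions are top-affordable at `y` (`y·Mᵢ ≤ q·Tᵢ`) and satisfy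
`TLB (y/(1−y)) (q·Tᵢ) Mᵢ (gate μᵢ q)`, the gated convolution satisfies `TLB (y/(1−y)) (q·(T₁+T₂)) (M₁+M₂) (gate (lconv M₁ M₂ μ₁ μ₂) q)`.
By `farTreeRow_of_tlbGateConvClosed` below this ALONE gives `Quant.FarTreeRow`.  Its `d = j` instances (dominant layers of the product)
are arm-2 g34's theorem `gateConv_tail_ge_dominant`.  Evidence: file header (0 exact failures; equality on E-tight blobs).
builds on p205010 (kernel theorem, internal audit signed; external expert review pending). [this work] [status: open] -/
@[conjecture] def TLBGateConvClosed : Prop :=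
  ∀ (y q : ℝ) (M₁ M₂ : ℕ) (μ₁ μ₂ : ℕ → ℝ),
    0 < y → y < 1 → 0 < q → q ≤ 1 →
    (∀ h, 0 ≤ μ₁ h) → (∀ h, M₁ < h → μ₁ h = 0) → (∑ h ∈ Finset.range (M₁ + 1), μ₁ h = 1) →
    y * (M₁ : ℝ) ≤ q * ∑ h ∈ Finset.range (M₁ + 1), (h : ℝ) * μ₁ h →
    (∀ h, 0 ≤ μ₂ h) → (∀ h, M₂ < h → μ₂ h = 0) → (∑ h ∈ Finset.range (M₂ + 1), μ₂ h = 1) →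
    y * (M₂ : ℝ) ≤ q * ∑ h ∈ Finset.range (M₂ + 1), (h : ℝ) * μ₂ h →
    TLB (y / (1 - y)) (q * ∑ h ∈ Finset.range (M₁ + 1), (h : ℝ) * μ₁ h) M₁ (gate μ₁ q) →
    TLB (y / (1 - y)) (q * ∑ h ∈ Finset.range (M₂ + 1), (h : ℝ) * μ₂ h) M₂ (gate μ₂ q) →
    TLB (y / (1 - y)) (q * ((∑ h ∈ Finset.range (M₁ + 1), (h : ℝ) * μ₁ h) + ∑ h ∈ Finset.range (M₂ + 1), (h : ℝ) * μ₂ h))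
      (M₁ + M₂) (gate (lconv M₁ M₂ μ₁ μ₂) q)

/-! ### STLB is closed under the cheap constructors -/

/-- `TLB` is antitone in the rate when the law is nonnegative. [this work] -/
theorem tlb_mono_rate {u u' τ : ℝ} {M : ℕ} {ν : ℕ → ℝ} (hν : ∀ h, 0 ≤ ν h) (huu : u' ≤ u) (h : TLB u τ M ν) :
    TLB u' τ M ν := by
  intro d hd
  have hs : 0 ≤ ∑ h ∈ Finset.range (d + 1), ν h := Finset.sum_nonneg fun k _ => hν k
  exact le_trans (mul_le_mul_of_nonneg_right huu hs) (h d hd)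

/-- **STLB is gate-closed** (gates compose; the target of `gate μ q` is `q · mean`). [this work] -/
theorem stlb_gate {x : ℝ} {M : ℕ} {μ : ℕ → ℝ} (h : STLB x M μ) (q : ℝ) (hq0 : 0 < q) (hq1 : q ≤ 1) :
    STLB (q * x) M (gate μ q) := by
  intro q' hq'0 hq'1
  rw [gate_gate, sum_mul_gate, show q' * (q * x) = (q' * q) * x by ring,
    show q' * (q * ∑ h ∈ Finset.range (M + 1), (h : ℝ) * μ h) = (q' * q) * ∑ h ∈ Finset.range (M + 1), (h : ℝ) * μ h by ring]
  exact h (q' * q) (mul_pos hq'0 hq0) (by nlinarith)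

/-- **STLB is monotone in the floor** (`0 ≤ x′ ≤ x`, `x < 1`, `μ ≥ 0`). [this work] -/
theorem stlb_mono {x x' : ℝ} {M : ℕ} {μ : ℕ → ℝ} (hμ : ∀ h, 0 ≤ μ h) (h : STLB x M μ) (hx'0 : 0 ≤ x') (hxx : x' ≤ x)
    (hx1 : x < 1) : STLB x' M μ := by
  intro q hq0 hq1
  have hqx : q * x < 1 := by nlinarith
  have hle : q * x' ≤ q * x := mul_le_mul_of_nonneg_left hxx hq0.le
  -- (the gated law is nonnegative; inlined — the named helper `gate_nonneg'` of p375030 now lives in `…QuantTwoLayerClosure`)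
  have hg : ∀ k, 0 ≤ gate μ q k := fun k => by
    simp only [gate]
    split_ifs
    · nlinarith [hμ k]
    · nlinarith [hμ k]
  refine tlb_mono_rate hg ?_ (h q hq0 hq1)
  rw [div_le_div_iff₀ (by nlinarith) (by linarith)]
  nlinarith

/-- **the empty law `δ₀` is STLB** (target `0`: no `d`). [this work] -/
theorem stlb_nil (x : ℝ) : STLB x 0 (fun h => if h = 0 then (1 : ℝ) else 0) := by
  intro q hq0 hq1 d hd
  exfalso
  have h0 : q * ∑ h ∈ Finset.range (0 + 1), (h : ℝ) * (if h = 0 then (1 : ℝ) else 0) = 0 := by simp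
  rw [h0] at hd
  have : (0 : ℝ) ≤ 2 * (d : ℝ) := by positivity
  linarith

/-- **the unit relay `δ₁` is STLB at every floor `x < 1`**: `gate δ₁ q = {0: 1−q, 1: q}`, target `q`, only `d = 0`:
`qx/(1−qx)·(1−q) ≤ q`. [this work] -/
theorem stlb_relay (x : ℝ) (hx1 : x < 1) : STLB x 1 (fun h => if h = 1 then (1 : ℝ) else 0) := by
  intro q hq0 hq1 d hd
  have hT : q * ∑ h ∈ Finset.range (1 + 1), (h : ℝ) * (if h = 1 then (1 : ℝ) else 0) = q := by
    simp
  rw [hT] at hd ⊢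
  have hd0 : d = 0 := by
    by_contra hne
    have : (1 : ℝ) ≤ d := by exact_mod_cast Nat.one_le_iff_ne_zero.mpr hne
    linarith
  subst hd0
  have hqx : q * x < 1 := by nlinarith [mul_pos hq0 (show (0 : ℝ) < 1 - x by linarith)]
  have hL : ∑ h ∈ Finset.range (0 + 1), gate (fun h => if h = 1 then (1 : ℝ) else 0) q h = 1 - q := by
    simp [gate]
  have hR : ∑ h ∈ Finset.range (1 + 1),
      (if q - ((0 : ℕ) : ℝ) ≤ (h : ℝ) then gate (fun h => if h = 1 then (1 : ℝ) else 0) q h else 0) = q := by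
    rw [Finset.sum_range_succ, Finset.sum_range_one]
    have e0 : ¬ (q - ((0 : ℕ) : ℝ) ≤ ((0 : ℕ) : ℝ)) := by push_cast; linarith
    have e1 : q - ((0 : ℕ) : ℝ) ≤ ((1 : ℕ) : ℝ) := by push_cast; linarith
    rw [if_neg e0, if_pos e1]
    simp [gate]
  rw [hL, hR, div_mul_eq_mul_div, div_le_iff₀ (by linarith)]
  nlinarith [mul_pos hq0 (show (0:ℝ) < 1 - q * x by linarith)]

/-- **STLB is closed under convolution, given the node** (apply `TLBGateConvClosed` at floor `q·x` for every gate `q`). [this work] -/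
theorem stlb_conv (hC : TLBGateConvClosed) {x : ℝ} {M₁ M₂ : ℕ} {μ₁ μ₂ : ℕ → ℝ} (hx0 : 0 < x) (hx1 : x < 1)
    (n1 : ∀ h, 0 ≤ μ₁ h) (z1 : ∀ h, M₁ < h → μ₁ h = 0) (s1 : ∑ h ∈ Finset.range (M₁ + 1), μ₁ h = 1)
    (t1 : x * (M₁ : ℝ) ≤ ∑ h ∈ Finset.range (M₁ + 1), (h : ℝ) * μ₁ h)
    (n2 : ∀ h, 0 ≤ μ₂ h) (z2 : ∀ h, M₂ < h → μ₂ h = 0) (s2 : ∑ h ∈ Finset.range (M₂ + 1), μ₂ h = 1)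
    (t2 : x * (M₂ : ℝ) ≤ ∑ h ∈ Finset.range (M₂ + 1), (h : ℝ) * μ₂ h)
    (h₁ : STLB x M₁ μ₁) (h₂ : STLB x M₂ μ₂) : STLB x (M₁ + M₂) (lconv M₁ M₂ μ₁ μ₂) := by
  intro q hq0 hq1
  rw [sum_mul_lconv _ _ _ _ s1 s2]
  have hy0 : 0 < q * x := mul_pos hq0 hx0
  have hy1 : q * x < 1 := by nlinarith
  exact hC (q * x) q M₁ M₂ μ₁ μ₂ hy0 hy1 hq0 hq1 n1 z1 s1 (by nlinarith) n2 z2 s2 (by nlinarith) (h₁ q hq0 hq1) (h₂ q hq0 hq1)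

/-! ### The structural induction and the tree row -/

/-- **THE STRUCTURAL INDUCTION (census-2 g53's `treeBuilt_sdec` with STLB in place of SDEC).**  Under `TLBGateConvClosed` every
tree-built law is STLB at its floor. [this work] -/
theorem treeBuilt_stlb (hC : TLBGateConvClosed) {x : ℝ} {M : ℕ} {μ : ℕ → ℝ} (h : TreeBuilt x M μ) : STLB x M μ := by
  induction h with
  | nil x₀ hx0 hx1 => exact stlb_nil x₀
  | relay x₀ hx0 hx1 => exact stlb_relay x₀ hx1
  | @conv x₀ M₁ M₂ μ₁ μ₂ h₁ h₂ ih₁ ih₂ =>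
    obtain ⟨hx0, hx1, n1, z1, s1, t1⟩ := treeBuilt_lawFacts h₁
    obtain ⟨_, _, n2, z2, s2, t2⟩ := treeBuilt_lawFacts h₂
    exact stlb_conv hC hx0 hx1 n1 z1 s1 t1 n2 z2 s2 t2 ih₁ ih₂
  | @gate x₀ M₀ μ₀ q hq0 hq1 h ih => exact stlb_gate ih q hq0 hq1
  | @mono x₀ x' M₀ μ₀ h hx'0 hxx ih =>
    obtain ⟨hx0, hx1, n1, _, _, _⟩ := treeBuilt_lawFacts h
    exact stlb_mono n1 ih hx'0.le hxx hx1

/-- **STLB ⟹ the far-relay row**: a nonnegative law on `{0..M}` (vanishing above `M`, mass `1`) that is STLB at floor `0 < x < 1` has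
`x ≤ μ{j+1..M}` at every layer `j` with `2j < mean` — the two-layer bound at `d = j` of the ungated law (`q = 1`), whose right side
lives on `h ≥ mean − j > j`. [this work] -/
theorem tail_ge_of_stlb {x : ℝ} {M : ℕ} {μ : ℕ → ℝ} (hx0 : 0 < x) (hx1 : x < 1) (hμ0 : ∀ h, 0 ≤ μ h)
    (hμ1 : ∑ h ∈ Finset.range (M + 1), μ h = 1) (hS : STLB x M μ) (j : ℕ)
    (hdom : (2 * j : ℝ) < ∑ h ∈ Finset.range (M + 1), (h : ℝ) * μ h) :
    x ≤ ∑ h ∈ Finset.Ico (j + 1) (M + 1), μ h := by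
  set T : ℝ := ∑ h ∈ Finset.range (M + 1), (h : ℝ) * μ h with hT
  have h1 := hS 1 one_pos le_rfl
  rw [gate_one, one_mul, one_mul] at h1
  have hd : 2 * ((j : ℕ) : ℝ) < T := by exact_mod_cast hdom
  have h2 := h1 j hd
  -- the right side is at most the tail above `j`
  have hR : ∑ h ∈ Finset.range (M + 1), (if T - j ≤ (h : ℝ) then μ h else 0) ≤ ∑ h ∈ Finset.Ico (j + 1) (M + 1), μ h := by
    have hsplit : ∑ h ∈ Finset.range (M + 1), (if T - j ≤ (h : ℝ) then μ h else 0)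
        = ∑ h ∈ Finset.Ico (j + 1) (M + 1), (if T - j ≤ (h : ℝ) then μ h else 0) := by
      symm
      refine Finset.sum_subset (fun h hh => ?_) (fun h hh hn => ?_)
      · rw [Finset.mem_Ico] at hh; exact Finset.mem_range.2 hh.2
      · rw [Finset.mem_range] at hh
        rw [Finset.mem_Ico, not_and'] at hn
        have hjh : ¬ j + 1 ≤ h := hn hh
        have : (h : ℝ) ≤ j := by exact_mod_cast Nat.lt_succ_iff.mp (not_le.mp hjh)
        rw [if_neg]
        intro hc
        have : (2 * j : ℝ) ≥ T := by linarith
        linarith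
    rw [hsplit]
    refine Finset.sum_le_sum fun h _ => ?_
    split_ifs
    · exact le_rfl
    · exact hμ0 h
  -- the left side is `x/(1−x)` times the mass up to `j`, and the two masses add up to `1`
  have hA : ∑ h ∈ Finset.range (j + 1), μ h + ∑ h ∈ Finset.Ico (j + 1) (M + 1), μ h ≥ 1 := by
    by_cases hjM : j + 1 ≤ M + 1
    · rw [← hμ1, ← Finset.sum_range_add_sum_Ico _ hjM]
    · have hsub : Finset.range (M + 1) ⊆ Finset.range (j + 1) := Finset.range_mono (le_of_lt (not_le.mp hjM))
      have := Finset.sum_le_sum_of_subset_of_nonneg hsub (fun k _ _ => hμ0 k)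
      have hI : 0 ≤ ∑ h ∈ Finset.Ico (j + 1) (M + 1), μ h := Finset.sum_nonneg fun k _ => hμ0 k
      linarith
  have h3 : x / (1 - x) * ∑ h ∈ Finset.range (j + 1), μ h ≤ ∑ h ∈ Finset.Ico (j + 1) (M + 1), μ h := h2.trans hR
  rw [div_mul_eq_mul_div, div_le_iff₀ (by linarith)] at h3
  have hB1 : ∑ h ∈ Finset.Ico (j + 1) (M + 1), μ h ≤ 1 := by
    calc ∑ h ∈ Finset.Ico (j + 1) (M + 1), μ h ≤ ∑ h ∈ Finset.range (M + 1), μ h :=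
          Finset.sum_le_sum_of_subset_of_nonneg (fun h hh => by
            rw [Finset.mem_Ico] at hh; exact Finset.mem_range.2 hh.2) (fun k _ _ => hμ0 k)
      _ = 1 := hμ1
  nlinarith [Finset.sum_nonneg (fun k (_ : k ∈ Finset.range (j + 1)) => hμ0 k)]

/-- **`TLBGateConvClosed ⟹ TreeBuiltFAR`** (the far-relay row for every tree-built law, with NO decomposition property). [this work] -/
theorem treeBuiltFAR_of_tlbGateConvClosed (hC : TLBGateConvClosed) : TreeBuiltFAR := by
  intro x M μ h j hdom
  obtain ⟨hx0, hx1, n1, _, s1, _⟩ := treeBuilt_lawFacts h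
  exact tail_ge_of_stlb hx0 hx1 n1 s1 (treeBuilt_stlb hC h) j hdom

end LawDec

/-- **`TLBGateConvClosed ⟹ Quant.FarTreeRow`**: the depth-0 single-gate closure of the two-layer-bound family gives the far-relay row on
every rooted weighted forest (lead g20's bridge `farTreeRow_of_treeBuiltFAR`). [this work] -/
theorem farTreeRow_of_tlbGateConvClosed (hC : LawDec.TLBGateConvClosed) : FarTreeRow :=
  farTreeRow_of_treeBuiltFAR (LawDec.treeBuiltFAR_of_tlbGateConvClosed hC)

end Quant

end Summit.CriticalPhenomena.PercolationContinuityZ3.Theorems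

/-! ## CORRECTION OF RECORD (lead g37, same session, one hour after the statement above): THE NODE `TLBGateConvClosed` IS FALSE

The header's "the tree row NEEDS NO DEC" and the docstring's `[status: open]` of `LawDec.TLBGateConvClosed` are SUPERSEDED by the
kernel refutation below (append-only file: the earlier text cannot be edited).  The proposer's own adversarial census (kit
j211243 / j211244: alternating HiGHS LP maximising one product two-layer bound over the two factor polytopes {mass, mean, TLB rows},
exact re-check) found genuine violations as soon as `max(M₁, M₂) ≥ 10` — all with floor `y ∈ (0.35, 0.5)`; the sampling censuses at
`M ≤ 9` and the exact adversary at `M ≤ 7` quoted above could not see them.  EXACT WITNESS: `q = 1`, `y = 9/20` (`u = 9/11`),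
`μ₁ = {0: 11/20, 1: 9/20}` (`= gate δ₁ (9/20)`, itself a TREE law: one relay behind one edge), `μ₂ = {1: 33/61, 2: 11/1220, 4: 9/1220,
12: 27/61}` (mean `59/10`, top-affordable `12·9/20 ≤ 59/10`, ALL two-layer bounds hold — tightly at `d = 1, 2` — but NOT DEC: at layers
`4..11` its low atom `2` has only the heavy mid `4`, usage `≈ 2.85 ≫ u`); the convolution violates the two-layer bound at `d = 2`
(`τ = 127/20`, right side `ν{≥ 5}`) by `u·μ₂(2)·(1 − 2y) = 9/12200`.  CONSEQUENCES: (i) the class {top-affordable + all two-layer bounds}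
is NOT closed under convolution even without a gate, so no depth-0 invariant carries the tree induction — it must see the window rates
(DEC, or at least census-2 g63's depth-≥1 rows: `μ₂` fails `TLCR(4,2)`); (ii) the violating family is `∝ (1 − 2y)`: every violation
found has `y < 1/2`, and the HEAVY half (`1/2 ≤ y`, rate `u ≥ 1`) is alive — typed, with its own reduction to the tree row on forests
whose marginals exceed `1/2`, in `…QuantTLBClosureHeavy` (lead g37 / arm-2 g38); (iii) with the mean equality dropped the statement
fails already at small `M` (kit j211245; census-2 g63 exact: `q = 3/4`, `y = 3/8`, `μ₁ = μ₂ = {0: ½, 1: ½}` at target `4/3`).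
Recorded as a refuted variant (lane STATEMENTS §K). -/

namespace Summit.CriticalPhenomena.PercolationContinuityZ3.Theorems

namespace Quant

open Finset

namespace LawDec

/-- **THE DEPTH-0 CLOSURE IS FALSE** (lead g37; found by the kit adversary j211243/j211244, exactified by hand).  Witness: `y = 9/20`, `q = 1`,
`μ₁ = {0: 11/20, 1: 9/20}` (`= gate δ₁ (9/20)`, a tree law) and `μ₂ = {1: 33/61, 2: 11/1220, 4: 9/1220, 12: 27/61}` (mean `59/10`,
top-affordable, every two-layer bound holds — tightly at `d = 1, 2` — but NOT DEC: its low atom `2` has only the heavy mid `4`); the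
convolution violates the two-layer bound at `d = 2` (`τ = 127/20`, right side = `ν{≥ 5}`) by `9/12200`. [this work] -/
theorem not_tlbGateConvClosed : ¬ TLBGateConvClosed := by
  intro H
  have hy0 : (0 : ℝ) < 9 / 20 := by norm_num
  have hy1 : (9 / 20 : ℝ) < 1 := by norm_num
  let μ₁ : ℕ → ℝ := fun h => if h = 0 then 11 / 20 else if h = 1 then 9 / 20 else 0
  let μ₂ : ℕ → ℝ := fun h => if h = 1 then 33 / 61 else if h = 2 then 11 / 1220 else if h = 4 then 9 / 1220 else
    if h = 12 then 27 / 61 else 0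
  have n1 : ∀ h, 0 ≤ μ₁ h := by intro h; simp only [μ₁]; split_ifs <;> norm_num
  have z1 : ∀ h, 1 < h → μ₁ h = 0 := by intro h hh; simp only [μ₁]; rw [if_neg (by omega), if_neg (by omega)]
  have s1 : ∑ h ∈ Finset.range (1 + 1), μ₁ h = 1 := by simp only [μ₁, Finset.sum_range_succ, Finset.sum_range_zero]; norm_num
  have m1 : ∑ h ∈ Finset.range (1 + 1), (h : ℝ) * μ₁ h = 9 / 20 := by
    simp only [μ₁, Finset.sum_range_succ, Finset.sum_range_zero]; norm_num
  have n2 : ∀ h, 0 ≤ μ₂ h := by intro h; simp only [μ₂]; split_ifs <;> norm_num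
  have z2 : ∀ h, 12 < h → μ₂ h = 0 := by
    intro h hh; simp only [μ₂]; rw [if_neg (by omega), if_neg (by omega), if_neg (by omega), if_neg (by omega)]
  have s2 : ∑ h ∈ Finset.range (12 + 1), μ₂ h = 1 := by simp only [μ₂, Finset.sum_range_succ, Finset.sum_range_zero]; norm_num
  have m2 : ∑ h ∈ Finset.range (12 + 1), (h : ℝ) * μ₂ h = 59 / 10 := by
    simp only [μ₂, Finset.sum_range_succ, Finset.sum_range_zero]; norm_num
  have t1 : (9 / 20 : ℝ) * ((1 : ℕ) : ℝ) ≤ 1 * ∑ h ∈ Finset.range (1 + 1), (h : ℝ) * μ₁ h := by rw [m1]; norm_num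
  have t2 : (9 / 20 : ℝ) * ((12 : ℕ) : ℝ) ≤ 1 * ∑ h ∈ Finset.range (12 + 1), (h : ℝ) * μ₂ h := by rw [m2]; norm_num
  have c1 : TLB ((9 / 20) / (1 - 9 / 20)) (1 * ∑ h ∈ Finset.range (1 + 1), (h : ℝ) * μ₁ h) 1 (gate μ₁ 1) := by
    rw [m1, gate_one]
    intro d hd
    have hd0 : d = 0 := by
      by_contra hne
      have : (1 : ℝ) ≤ d := by exact_mod_cast Nat.one_le_iff_ne_zero.mpr hne
      linarith
    subst hd0
    simp only [μ₁, Finset.sum_range_succ, Finset.sum_range_zero]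
    norm_num
  have c2 : TLB ((9 / 20) / (1 - 9 / 20)) (1 * ∑ h ∈ Finset.range (12 + 1), (h : ℝ) * μ₂ h) 12 (gate μ₂ 1) := by
    rw [m2, gate_one]
    intro d hd
    have hd2 : d ≤ 2 := by
      by_contra hne
      have : (3 : ℝ) ≤ d := by exact_mod_cast Nat.lt_of_not_le hne
      linarith
    interval_cases d <;> simp only [μ₂, Finset.sum_range_succ, Finset.sum_range_zero] <;> norm_num
  have P := H (9 / 20) 1 1 12 μ₁ μ₂ hy0 hy1 one_pos le_rfl n1 z1 s1 t1 n2 z2 s2 t2 c1 c2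
  rw [m1, m2, gate_one] at P
  have P2 := P 2 (by norm_num)
  simp only [lconv, μ₁, μ₂, Finset.sum_range_succ, Finset.sum_range_zero] at P2
  norm_num at P2

end LawDec

end Quant

end Summit.CriticalPhenomena.PercolationContinuityZ3.Theorems
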